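import Mathlib
import Summits.NavierStokesRegularity.NavierStokesRegularity.Theorems.EulerZoomLiouvillePowerGaugeEulerLiouvilleWeakFlowJacobian
import Summits.NavierStokesRegularity.NavierStokesRegularity.Theorems.EulerZoomLiouvillePowerGaugeEulerLiouvilleWeakChainRuleSmooth
import Summits.NavierStokesRegularity.NavierStokesRegularity.Theorems.EulerZoomLiouvillePowerGaugeEulerLiouvilleWeakChainRuleTools
import Summits.NavierStokesRegularity.NavierStokesRegularity.Theorems.EulerZoomLiouvillePowerGaugeEulerLiouvilleWeakRenormalizedTransport
import Literature.Analysis.FunctionSpaces.Mollification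
import HarnessLib

/-!
# Crux `EulerZoomLiouville.PowerGaugeEulerLiouville` (stmt-NavierStokesRegularity-19832), weak stratum, line `weak_lagrangian` (ns-idea-11 g9):
# THE LAGRANGIAN CHAIN RULE FOR SOBOLEV OBSERVABLES ALONG A.E. BACKWARD ORBIT — `stub_chainRule` (F2) filled

Route №10 `EulerZoomLiouville` (NavierStokesRegularity), crux E = stmt-NavierStokesRegularity-19832; width seat ns-ezl-w1 g8 under the LEAD ns-typeII-p2 g14.
Assembly (stage D) of F2 over the bricks `…WeakChainRuleSmooth` (C¹ observables along one integral curve), `…WeakFlowJacobian` (flow–Tonelli with the Jacobian law),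
`…WeakChainRuleTools` (a.e. subsequences, local `L^{3/2}` convergence of mollified gradients, Hölder).  For `V ∈ L⁶_loc`, a jointly measurable `Ψ` whose a.e.
label is an integral curve of `−W` (`W = selfSimilarTransport γ 0 V`) with the exact Jacobian law `(Ψ_σ)_# vol = e^{3γσ} vol`, and every `f ∈ L¹_loc` with
whole-space weak gradient `g ∈ L^{3/2}_loc`:

  for every `σ ≥ 0` and a.e. `y`:  `s ↦ g(Ψ_s y)[W(Ψ_s y)]` is integrable on `(0,σ)` and `f(Ψ_σ y) = f(y) − ∫₀^σ g(Ψ_s y)[W(Ψ_s y)] ds`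

(`chainRule_core`).  Proof: mollify `f_n = φ_n ⋆ f` (`Df_n = φ_n ⋆ g`); the C¹ chain rule holds for every `f_n` at a.e. label; `f_n → f` a.e. and (Jacobian law)
`f_n(Ψ_σ y) → f(Ψ_σ y)` a.e.; for labels whose (continuous) orbit stays in `B(0,M)` on `[0,σ]`, flow–Tonelli gives
`∫_y ∫₀^σ ‖Df_n − g‖‖W‖(Ψ_s y)𝟙_{B_M} ≤ σ e^{3γσ} ‖Df_n − g‖_{L^{3/2}(B_M)} ‖W‖_{L³(B_M)} → 0`, so along a subsequence the error integrals vanish for a.e.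
label (Borel–Cantelli), and every a.e. orbit lies in some `B(0,M)`.  `chainRule` = `Sig.stub_chainRule` of the line with its reducible predicates δ-unfolded
(the line fills it by `exact WeakLagrangian.chainRule …`).
WHAT THIS IS NOT: not NS, not E, not M1 (the flow `Ψ` is a HYPOTHESIS) — 19832 is OPEN. [folklore; AmbrosioCrippa2008 §5; DiPernaLions1989 §II]
-/

noncomputable section

-- flat `Theorems/<Route><Decl>…` files of one crux share the namespace of the crux (tree convention)
set_option linter.dupNamespace false

open MeasureTheory Set Filter Topology Metric Function TopologicalSpace ContinuousLinearMap intervalIntegral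
open scoped ENNReal NNReal Convolution InnerProductSpace RealInnerProductSpace ContDiff

namespace Summit.NavierStokesRegularity.NavierStokesRegularity.Theorems.PowerGaugeEulerLiouville.WeakLagrangian

open Literature.Analysis Literature.Analysis.FunctionSpaces Literature.Analysis.FluidPDE
open Summit.NavierStokesRegularity.NavierStokesRegularity.Theorems.PowerGaugeEulerLiouville

/-- `‖L v‖ₑ ≤ ‖L‖ₑ ‖v‖ₑ` for a continuous linear map. [folklore] -/
theorem enorm_apply_le {E F : Type*} [NormedAddCommGroup E] [NormedSpace ℝ E] [NormedAddCommGroup F] [NormedSpace ℝ F]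
    (L : E →L[ℝ] F) (v : E) : ‖L v‖ₑ ≤ ‖L‖ₑ * ‖v‖ₑ := by
  rw [enorm_eq_nnnorm, enorm_eq_nnnorm, enorm_eq_nnnorm, ← ENNReal.coe_mul, ENNReal.coe_le_coe]
  exact L.le_opNNNorm v

section Core

variable {γ₀ : ℝ} {V : EuclideanSpace ℝ (Fin 3) → EuclideanSpace ℝ (Fin 3)}
  {Ψ : ℝ → EuclideanSpace ℝ (Fin 3) → EuclideanSpace ℝ (Fin 3)}

/-- **THE LAGRANGIAN CHAIN RULE FOR SOBOLEV OBSERVABLES (core form).**  `γ ≥ 0`, `V ∈ L⁶(B(0,r))` for all `r` and a.e.-strongly measurable; `Ψ` jointly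
measurable, a.e. label an integral curve of `−W` on `[0,∞)` in integral form, Jacobian law `(Ψ_σ)_# vol = e^{3γσ} vol` (`σ ≥ 0`); `f ∈ L¹_loc` with whole-space
weak gradient `g`, `g ∈ L^{3/2}(B(0,r))` for all `r`.  Then for every `σ ≥ 0` and a.e. `y`: `s ↦ g(Ψ_s y)[W(Ψ_s y)]` is integrable on `(0,σ)` and
`f(Ψ_σ y) = f(y) − ∫₀^σ g(Ψ_s y)[W(Ψ_s y)] ds`. [folklore; AmbrosioCrippa2008 §5] -/
theorem chainRule_core (hγ₀ : 0 ≤ γ₀) (hVm : AEStronglyMeasurable V volume)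
    (hV6 : ∀ r : ℝ, MemLp V 6 (volume.restrict (ball (0 : EuclideanSpace ℝ (Fin 3)) r)))
    (hΨm : Measurable (Function.uncurry Ψ))
    (hcurve : ∀ᵐ y ∂(volume : Measure (EuclideanSpace ℝ (Fin 3))), ∀ σ : ℝ, 0 ≤ σ →
      IntervalIntegrable (fun s => selfSimilarTransport γ₀ 0 V (Ψ s y)) volume 0 σ ∧
        Ψ σ y = y - ∫ s in (0 : ℝ)..σ, selfSimilarTransport γ₀ 0 V (Ψ s y))
    (hjac : ∀ σ : ℝ, 0 ≤ σ →
      Measure.map (Ψ σ) (volume : Measure (EuclideanSpace ℝ (Fin 3))) =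
        ENNReal.ofReal (Real.exp (3 * γ₀ * σ)) • (volume : Measure (EuclideanSpace ℝ (Fin 3))))
    {f : EuclideanSpace ℝ (Fin 3) → ℝ} {g : EuclideanSpace ℝ (Fin 3) → EuclideanSpace ℝ (Fin 3) →L[ℝ] ℝ}
    (hfg : HasWeakFDerivOn (⊤ : Opens (EuclideanSpace ℝ (Fin 3))) volume f g)
    (hg : ∀ r : ℝ, MemLp g (3 / 2 : ℝ≥0∞) (volume.restrict (ball (0 : EuclideanSpace ℝ (Fin 3)) r)))
    {σ : ℝ} (hσ : 0 ≤ σ) :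
    ∀ᵐ y ∂(volume : Measure (EuclideanSpace ℝ (Fin 3))),
      IntervalIntegrable (fun s => g (Ψ s y) (selfSimilarTransport γ₀ 0 V (Ψ s y))) volume 0 σ ∧
        f (Ψ σ y) = f y - ∫ s in (0 : ℝ)..σ, g (Ψ s y) (selfSimilarTransport γ₀ 0 V (Ψ s y)) := by
  -- ### notation and basic facts
  set W : EuclideanSpace ℝ (Fin 3) → EuclideanSpace ℝ (Fin 3) := selfSimilarTransport γ₀ 0 V with hWdef
  set J : ℝ → ℝ≥0∞ := fun s => ENNReal.ofReal (Real.exp (3 * γ₀ * s)) with hJdef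
  have hjac' : ∀ s : ℝ, 0 ≤ s →
      Measure.map (Ψ s) (volume : Measure (EuclideanSpace ℝ (Fin 3))) = J s • (volume : Measure (EuclideanSpace ℝ (Fin 3))) :=
    fun s hs => hjac s hs
  have hJle : ∀ s ∈ Icc 0 σ, J s ≤ J σ := fun s hs => by
    refine ENNReal.ofReal_le_ofReal (Real.exp_le_exp.2 ?_)
    exact mul_le_mul_of_nonneg_left hs.2 (by positivity)
  have hJσ : J σ ≠ ⊤ := ENNReal.ofReal_ne_top
  have hWm : AEStronglyMeasurable W volume := by
    have h1 : W = fun y => γ₀ • (y - 0) + V y := funext fun y => by rw [hWdef, selfSimilarTransport_apply]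
    rw [h1]
    exact (by fun_prop : Continuous fun y : EuclideanSpace ℝ (Fin 3) => γ₀ • (y - 0)).aestronglyMeasurable.add hVm
  have hW3 : ∀ r : ℝ, MemLp W 3 (volume.restrict (ball (0 : EuclideanSpace ℝ (Fin 3)) r)) := fun r => by
    haveI : IsFiniteMeasure ((volume : Measure (EuclideanSpace ℝ (Fin 3))).restrict (ball (0 : EuclideanSpace ℝ (Fin 3)) r)) :=
      isFiniteMeasure_restrict.2 measure_ball_lt_top.ne
    exact (WeakRenormalized.memLp_transport_six (γ := γ₀) (hV6 r)).mono_exponent (by norm_num)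
  have hfl : LocallyIntegrable f volume := locallyIntegrableOn_univ.1 (by
    simpa only [Opens.coe_top] using hfg.locallyIntegrableOn)
  have hgl : LocallyIntegrable g volume := locallyIntegrableOn_univ.1 (by
    simpa only [Opens.coe_top] using hfg.locallyIntegrableOn_deriv)
  have hgm : AEStronglyMeasurable g volume := hgl.aestronglyMeasurable
  -- measurable representatives
  set gm : EuclideanSpace ℝ (Fin 3) → EuclideanSpace ℝ (Fin 3) →L[ℝ] ℝ := hgm.mk g with hgmdef
  set Wm : EuclideanSpace ℝ (Fin 3) → EuclideanSpace ℝ (Fin 3) := hWm.mk W with hWmdef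
  have hgm_m : Measurable gm := hgm.stronglyMeasurable_mk.measurable
  have hWm_m : Measurable Wm := hWm.stronglyMeasurable_mk.measurable
  have hgae : g =ᵐ[volume] gm := hgm.ae_eq_mk
  have hWae : W =ᵐ[volume] Wm := hWm.ae_eq_mk
  -- ### the mollified observables
  obtain ⟨φ, hφ0, hφ2⟩ := exists_contDiffBump_seq (E := EuclideanSpace ℝ (Fin 3))
  set fn : ℕ → EuclideanSpace ℝ (Fin 3) → ℝ := fun n => (φ n).normed volume ⋆[lsmul ℝ ℝ, volume] f with hfndef
  have hfn1 : ∀ n, ContDiff ℝ 1 (fn n) := fun n => hfg.contDiff_convolution (isTestFunctionOn_normed (φ n))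
  have hDfn : ∀ n x, fderiv ℝ (fn n) x = ((φ n).normed volume ⋆[lsmul ℝ ℝ, volume] g) x := fun n x =>
    (hfg.hasFDerivAt_convolution (isTestFunctionOn_normed (φ n)) x).fderiv
  have hDfnc : ∀ n, Continuous ((φ n).normed volume ⋆[lsmul ℝ ℝ, volume] g) := fun n =>
    ((φ n).hasCompactSupport_normed (μ := volume)).continuous_convolution_left _ (φ n).continuous_normed hgl
  -- ### a.e. facts
  have hCRn : ∀ᵐ y ∂(volume : Measure (EuclideanSpace ℝ (Fin 3))), ∀ n : ℕ,
      IntervalIntegrable (fun s => fderiv ℝ (fn n) (Ψ s y) (W (Ψ s y))) volume 0 σ ∧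
        fn n (Ψ σ y) = fn n y - ∫ s in (0 : ℝ)..σ, fderiv ℝ (fn n) (Ψ s y) (W (Ψ s y)) :=
    ae_all_iff.2 fun n => chainRule_of_contDiff hcurve (hfn1 n) hσ
  have hlim0 : ∀ᵐ y ∂(volume : Measure (EuclideanSpace ℝ (Fin 3))), Tendsto (fun n => fn n y) atTop (𝓝 (f y)) :=
    ae_tendsto_normed_convolution hφ0 hφ2 hfl
  have hlimσ : ∀ᵐ y ∂(volume : Measure (EuclideanSpace ℝ (Fin 3))), Tendsto (fun n => fn n (Ψ σ y)) atTop (𝓝 (f (Ψ σ y))) :=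
    ae_comp_slice hΨm (hjac' σ hσ) hlim0
  have hrep : ∀ᵐ y ∂(volume : Measure (EuclideanSpace ℝ (Fin 3))), ∀ᵐ s ∂((volume : Measure ℝ).restrict (Ioc 0 σ)),
      g (Ψ s y) = gm (Ψ s y) ∧ W (Ψ s y) = Wm (Ψ s y) :=
    ae_ae_comp_of_ae hΨm hjac' (hgae.and hWae) σ
  -- the majorants on balls
  set HM : ℕ → EuclideanSpace ℝ (Fin 3) → ℝ≥0∞ := fun M => (ball (0 : EuclideanSpace ℝ (Fin 3)) M).indicator fun z => ‖gm z‖ₑ * ‖Wm z‖ₑ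
    with hHMdef
  have hHMm : ∀ M, Measurable (HM M) := fun M => ((hgm_m.enorm).mul hWm_m.enorm).indicator measurableSet_ball
  have hHMfin : ∀ M : ℕ, ∫⁻ z, HM M z ≠ ⊤ := by
    intro M
    simp only [hHMdef]
    rw [lintegral_indicator measurableSet_ball]
    have e : ∫⁻ z in ball (0 : EuclideanSpace ℝ (Fin 3)) M, ‖gm z‖ₑ * ‖Wm z‖ₑ = ∫⁻ z in ball (0 : EuclideanSpace ℝ (Fin 3)) M, ‖g z‖ₑ * ‖W z‖ₑ := by
      refine lintegral_congr_ae ?_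
      filter_upwards [ae_restrict_of_ae hgae, ae_restrict_of_ae hWae] with z h1 h2
      rw [← h1, ← h2]
    rw [e]
    refine ne_of_lt (lt_of_le_of_lt (setLIntegral_mul_le_holder32 hgm.restrict hWm.restrict) ?_)
    refine ENNReal.mul_lt_top (ENNReal.rpow_lt_top_of_nonneg (by norm_num) (ne_of_lt ?_))
      (ENNReal.rpow_lt_top_of_nonneg (by norm_num) (ne_of_lt ?_))
    · have h := (eLpNorm_lt_top_iff_lintegral_rpow_enorm_lt_top (p := (3 / 2 : ℝ≥0∞)) (by simp)
        (ENNReal.div_ne_top ENNReal.ofNat_ne_top two_ne_zero)).1 (hg M).eLpNorm_lt_top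
      have e32 : (3 / 2 : ℝ≥0∞).toReal = 3 / 2 := by rw [ENNReal.toReal_div]; norm_num
      rwa [e32] at h
    · have h := (eLpNorm_lt_top_iff_lintegral_rpow_enorm_lt_top (p := (3 : ℝ≥0∞)) (by norm_num) ENNReal.ofNat_ne_top).1
        (hW3 M).eLpNorm_lt_top
      simpa only [ENNReal.toReal_ofNat] using h
  have hfinM : ∀ᵐ y ∂(volume : Measure (EuclideanSpace ℝ (Fin 3))), ∀ M : ℕ, ∫⁻ s in Ioc 0 σ, HM M (Ψ s y) < ⊤ :=
    ae_all_iff.2 fun M => ae_setLIntegral_comp_lt_top hΨm hjac' hJσ hJle (hHMm M) (hHMfin M)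
  -- the error functionals and their a.e. decay along subsequences
  set KM : ℕ → ℕ → EuclideanSpace ℝ (Fin 3) → ℝ≥0∞ := fun M n =>
    (ball (0 : EuclideanSpace ℝ (Fin 3)) M).indicator fun z => ‖((φ n).normed volume ⋆[lsmul ℝ ℝ, volume] g) z - gm z‖ₑ * ‖Wm z‖ₑ with hKMdef
  have hKMm : ∀ M n, Measurable (KM M n) := fun M n =>
    ((((hDfnc n).measurable.sub hgm_m).enorm).mul hWm_m.enorm).indicator measurableSet_ball
  have hKtend : ∀ M : ℕ, Tendsto (fun n => ∫⁻ y, ∫⁻ s in Ioc 0 σ, KM M n (Ψ s y)) atTop (𝓝 0) := by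
    intro M
    have hT : ∀ n, ∫⁻ y, ∫⁻ s in Ioc 0 σ, KM M n (Ψ s y) ≤
        J σ * volume (Ioc (0 : ℝ) σ) * ∫⁻ z in ball (0 : EuclideanSpace ℝ (Fin 3)) M,
          ‖((φ n).normed volume ⋆[lsmul ℝ ℝ, volume] g) z - g z‖ₑ * ‖W z‖ₑ := by
      intro n
      rw [lintegral_lintegral_comp hΨm hjac' (hKMm M n) σ]
      have e : ∫⁻ z, KM M n z = ∫⁻ z in ball (0 : EuclideanSpace ℝ (Fin 3)) M,
          ‖((φ n).normed volume ⋆[lsmul ℝ ℝ, volume] g) z - g z‖ₑ * ‖W z‖ₑ := by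
        simp only [hKMdef]
        rw [lintegral_indicator measurableSet_ball]
        refine lintegral_congr_ae ?_
        filter_upwards [ae_restrict_of_ae hgae, ae_restrict_of_ae hWae] with z h1 h2
        rw [← h1, ← h2]
      rw [e]
      calc ∫⁻ s in Ioc 0 σ, J s * ∫⁻ z in ball (0 : EuclideanSpace ℝ (Fin 3)) M,
            ‖((φ n).normed volume ⋆[lsmul ℝ ℝ, volume] g) z - g z‖ₑ * ‖W z‖ₑ
          ≤ ∫⁻ _ in Ioc 0 σ, J σ * ∫⁻ z in ball (0 : EuclideanSpace ℝ (Fin 3)) M,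
            ‖((φ n).normed volume ⋆[lsmul ℝ ℝ, volume] g) z - g z‖ₑ * ‖W z‖ₑ :=
            setLIntegral_mono measurable_const fun s hs => mul_le_mul' (hJle s (Ioc_subset_Icc_self hs)) le_rfl
        _ = _ := by rw [setLIntegral_const]; ring
    have h0 := tendsto_setLIntegral_mollify_sub_mul hφ0 hgm hg (hW3 M)
    have h1 : Tendsto (fun n => J σ * volume (Ioc (0 : ℝ) σ) * ∫⁻ z in ball (0 : EuclideanSpace ℝ (Fin 3)) M,
        ‖((φ n).normed volume ⋆[lsmul ℝ ℝ, volume] g) z - g z‖ₑ * ‖W z‖ₑ) atTop (𝓝 0) := by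
      have hCtop : J σ * volume (Ioc (0 : ℝ) σ) ≠ ⊤ :=
        ENNReal.mul_ne_top hJσ (measure_Ioc_lt_top (μ := (volume : Measure ℝ))).ne
      have h2 := ENNReal.Tendsto.const_mul h0 (Or.inr hCtop)
      rwa [mul_zero] at h2
    exact tendsto_of_tendsto_of_tendsto_of_le_of_le' tendsto_const_nhds h1 (Eventually.of_forall fun n => bot_le)
      (Eventually.of_forall hT)
  have hFm : ∀ M n, AEMeasurable (fun y => ∫⁻ s in Ioc 0 σ, KM M n (Ψ s y)) (volume : Measure (EuclideanSpace ℝ (Fin 3))) := by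
    intro M n
    have h1 : Measurable (Function.uncurry fun (y : EuclideanSpace ℝ (Fin 3)) (s : ℝ) => KM M n (Ψ s y)) :=
      (hKMm M n).comp (hΨm.comp measurable_swap)
    exact h1.lintegral_prod_right.aemeasurable
  choose m hm0 hmtend hmae using fun M : ℕ =>
    exists_seq_tendsto_ae_of_tendsto_lintegral (μ := (volume : Measure (EuclideanSpace ℝ (Fin 3)))) (hFm M) (hKtend M) 0
  have hconv : ∀ᵐ y ∂(volume : Measure (EuclideanSpace ℝ (Fin 3))), ∀ M : ℕ,
      Tendsto (fun k => ∫⁻ s in Ioc 0 σ, KM M (m M k) (Ψ s y)) atTop (𝓝 0) :=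
    ae_all_iff.2 fun M => hmae M
  -- ### assembly
  filter_upwards [hcurve, hCRn, hlim0, hlimσ, hrep, hfinM, hconv] with y hcy hCRy h0y hσy hrepy hfiny hconvy
  -- the orbit is continuous on `[0,σ]`, hence inside some ball `B(0,M)`
  have hγc : ContinuousOn (fun s => Ψ s y) (Icc 0 σ) := by
    have h1 : ContinuousOn (fun s => y - ∫ r in (0 : ℝ)..s, W (Ψ r y)) (uIcc 0 σ) :=
      continuousOn_const.sub (continuousOn_primitive_interval' (hcy σ hσ).1 (by rw [uIcc_of_le hσ]; exact ⟨le_rfl, hσ⟩))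
    rw [uIcc_of_le hσ] at h1
    exact h1.congr fun s hs => (hcy s hs.1).2
  obtain ⟨C, hC⟩ := (isCompact_Icc (a := (0 : ℝ)) (b := σ)).exists_bound_of_continuousOn hγc
  set M : ℕ := ⌊C⌋₊ + 1 with hMdef
  have hMC : C < M := by rw [hMdef]; push_cast; exact Nat.lt_floor_add_one C
  have horb : ∀ s ∈ Icc 0 σ, Ψ s y ∈ ball (0 : EuclideanSpace ℝ (Fin 3)) M := fun s hs => by
    rw [mem_ball, dist_zero_right]; exact lt_of_le_of_lt (hC s hs) hMC
  -- the limit integrand is integrable on `(0,σ)`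
  have hum : AEStronglyMeasurable (fun s => gm (Ψ s y) (Wm (Ψ s y))) ((volume : Measure ℝ).restrict (Ioc 0 σ)) := by
    have h1 : Measurable fun s => gm (Ψ s y) := hgm_m.comp hΨm.of_uncurry_right
    have h2 : Measurable fun s => Wm (Ψ s y) := hWm_m.comp hΨm.of_uncurry_right
    exact (ContinuousLinearMap.id ℝ (EuclideanSpace ℝ (Fin 3) →L[ℝ] ℝ)).aestronglyMeasurable_comp₂
      h1.aestronglyMeasurable h2.aestronglyMeasurable
  have hueq : (fun s => g (Ψ s y) (W (Ψ s y))) =ᵐ[(volume : Measure ℝ).restrict (Ioc 0 σ)] fun s => gm (Ψ s y) (Wm (Ψ s y)) := by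
    filter_upwards [hrepy] with s hs
    rw [hs.1, hs.2]
  have hubound : ∀ᵐ s ∂((volume : Measure ℝ).restrict (Ioc 0 σ)), ‖gm (Ψ s y) (Wm (Ψ s y))‖ₑ ≤ HM M (Ψ s y) := by
    rw [ae_restrict_iff' measurableSet_Ioc]
    refine Eventually.of_forall fun s hs => ?_
    simp only [hHMdef, indicator_of_mem (horb s (Ioc_subset_Icc_self hs))]
    exact enorm_apply_le _ _
  have huint : IntegrableOn (fun s => g (Ψ s y) (W (Ψ s y))) (Ioc 0 σ) volume := by
    refine (Integrable.congr ?_ hueq.symm)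
    refine ⟨hum, ?_⟩
    exact lt_of_le_of_lt (lintegral_mono_ae hubound) (hfiny M)
  have hu : IntervalIntegrable (fun s => g (Ψ s y) (W (Ψ s y))) volume 0 σ :=
    (intervalIntegrable_iff_integrableOn_Ioc_of_le hσ).2 huint
  refine ⟨hu, ?_⟩
  -- the error integrals along the subsequence `m M k` vanish
  set I : ℕ → ℝ := fun n => ∫ s in (0 : ℝ)..σ, fderiv ℝ (fn n) (Ψ s y) (W (Ψ s y)) with hIdef
  set Iinf : ℝ := ∫ s in (0 : ℝ)..σ, g (Ψ s y) (W (Ψ s y)) with hIinfdef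
  have herr : ∀ n, (∫⁻ s in Ioc 0 σ, KM M n (Ψ s y)) ≠ ⊤ → ‖I n - Iinf‖ ≤ (∫⁻ s in Ioc 0 σ, KM M n (Ψ s y)).toReal := by
    intro n hfin
    have hIn := (hCRy n).1
    rw [hIdef, hIinfdef, ← integral_sub hIn hu]
    have hdint : IntegrableOn (fun s => fderiv ℝ (fn n) (Ψ s y) (W (Ψ s y)) - g (Ψ s y) (W (Ψ s y))) (Ioc 0 σ) volume :=
      ((intervalIntegrable_iff_integrableOn_Ioc_of_le hσ).1 hIn).sub huint
    calc ‖∫ s in (0 : ℝ)..σ, (fderiv ℝ (fn n) (Ψ s y) (W (Ψ s y)) - g (Ψ s y) (W (Ψ s y)))‖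
        ≤ ∫ s in (0 : ℝ)..σ, ‖fderiv ℝ (fn n) (Ψ s y) (W (Ψ s y)) - g (Ψ s y) (W (Ψ s y))‖ := norm_integral_le_integral_norm hσ
      _ = (∫⁻ s in Ioc 0 σ, ‖fderiv ℝ (fn n) (Ψ s y) (W (Ψ s y)) - g (Ψ s y) (W (Ψ s y))‖ₑ).toReal := by
          rw [integral_of_le hσ, integral_norm_eq_lintegral_enorm hdint.aestronglyMeasurable]
      _ ≤ (∫⁻ s in Ioc 0 σ, KM M n (Ψ s y)).toReal := by
          refine ENNReal.toReal_mono hfin (lintegral_mono_ae ?_)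
          filter_upwards [hrepy, ae_restrict_mem measurableSet_Ioc] with s hs hsI
          rw [hDfn n, hs.1, hs.2]
          simp only [hKMdef, indicator_of_mem (horb s (Ioc_subset_Icc_self hsI))]
          show ‖(((φ n).normed volume ⋆[lsmul ℝ ℝ, volume] g) (Ψ s y) - gm (Ψ s y)) (Wm (Ψ s y))‖ₑ ≤ _
          exact enorm_apply_le _ _
  have hIconv : Tendsto (fun k => I (m M k)) atTop (𝓝 Iinf) := by
    have hF := hconvy M
    have hfin : ∀ᶠ k in atTop, (∫⁻ s in Ioc 0 σ, KM M (m M k) (Ψ s y)) ≠ ⊤ :=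
      (hF.eventually (Iio_mem_nhds (zero_lt_one : (0 : ℝ≥0∞) < 1))).mono fun k hk => ne_top_of_lt hk
    have htoR : Tendsto (fun k => (∫⁻ s in Ioc 0 σ, KM M (m M k) (Ψ s y)).toReal) atTop (𝓝 0) := by
      have h := (ENNReal.tendsto_toReal ENNReal.zero_ne_top).comp hF
      rwa [ENNReal.toReal_zero] at h
    rw [← tendsto_sub_nhds_zero_iff]
    exact squeeze_zero_norm' (hfin.mono fun k hk => herr (m M k) hk) htoR
  -- pass to the limit in the identity for `f_{m M k}`
  have hL : Tendsto (fun k => fn (m M k) (Ψ σ y)) atTop (𝓝 (f (Ψ σ y))) := hσy.comp (hmtend M)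
  have hR : Tendsto (fun k => fn (m M k) y - I (m M k)) atTop (𝓝 (f y - Iinf)) := (h0y.comp (hmtend M)).sub hIconv
  have heqk : (fun k => fn (m M k) (Ψ σ y)) = fun k => fn (m M k) y - I (m M k) := funext fun k => (hCRy (m M k)).2
  rw [heqk] at hL
  exact tendsto_nhds_unique hL hR

end Core

/-! ### The line's stub, δ-unfolded -/

/-- **`stub_chainRule` (F2) of `Lines/weak_lagrangian.lean`**, with `InClass`, `IsExactlySelfSimilar`, `IsProfileGradient`, `IsBackwardFlow`, `HasChainRule`,
`transportW` δ-unfolded (the line fills it by `intro ρ hρ hρh u p H c V P G Ψ hcls hss hPG hΨ; exact WeakLagrangian.chainRule hρ hρh hcls hss hPG hΨ`):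
the backward regular Lagrangian flow of a weak class member transports every Sobolev observable `f ∈ W^{1,1}_loc` with `L^{3/2}_loc` gradient along a.e. orbit.
Only the profile data `V ∈ L⁶_loc` (from `IsProfileGradient`) and the flow clauses (measurability, a.e. integral curves, Jacobian law) are used.
[folklore; AmbrosioCrippa2008 §5] -/
theorem chainRule {ρ : ℝ} (hρ : 0 < ρ) (_hρh : ρ ≤ 1 / 2)
    {u : ℝ → EuclideanSpace ℝ (Fin 3) → EuclideanSpace ℝ (Fin 3)} {p : ℝ → EuclideanSpace ℝ (Fin 3) → ℝ}
    {H : ℝ → EuclideanSpace ℝ (Fin 3) → EuclideanSpace ℝ (Fin 3) →L[ℝ] EuclideanSpace ℝ (Fin 3)} {c : ℝ≥0}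
    {V : EuclideanSpace ℝ (Fin 3) → EuclideanSpace ℝ (Fin 3)} {P : EuclideanSpace ℝ (Fin 3) → ℝ}
    {G : EuclideanSpace ℝ (Fin 3) → EuclideanSpace ℝ (Fin 3) →L[ℝ] EuclideanSpace ℝ (Fin 3)}
    {Ψ : ℝ → EuclideanSpace ℝ (Fin 3) → EuclideanSpace ℝ (Fin 3)}
    (_hcls : IsSuitableWeakSolutionOn (slab (EuclideanSpace ℝ (Fin 3)) (Set.Iio 0) isOpen_Iio) 0 0 u p ∧
      HasWeakSpatialGradientOn (slab (EuclideanSpace ℝ (Fin 3)) (Set.Iio 0) isOpen_Iio) u H ∧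
      (∀ a : ℝ, 0 < a →
        ENNReal.ofReal (a ^ (2 * ρ)) * cknA a (0 : ℝ × EuclideanSpace ℝ (Fin 3)) u +
            ENNReal.ofReal (a ^ ρ) * cknE a (0 : ℝ × EuclideanSpace ℝ (Fin 3)) H +
          ENNReal.ofReal (a ^ (2 * ρ)) * cknD a (0 : ℝ × EuclideanSpace ℝ (Fin 3)) p ≤ (c : ℝ≥0∞)))
    (_hss : (∀ τ : ℝ, τ < 0 → u τ = selfSimilarCollapse (1 / (2 + ρ)) 0 V τ) ∧
      (∀ τ : ℝ, τ < 0 → p τ = selfSimilarCollapsePressure (1 / (2 + ρ)) 0 P τ))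
    (hPG : HasWeakFDerivOn (⊤ : Opens (EuclideanSpace ℝ (Fin 3))) volume V G ∧
      (∀ r : ℝ, MemLp G 2 (volume.restrict (ball (0 : EuclideanSpace ℝ (Fin 3)) r))) ∧
      (∀ r : ℝ, MemLp V 6 (volume.restrict (ball (0 : EuclideanSpace ℝ (Fin 3)) r))) ∧
      HasWeakFDerivOn (⊤ : Opens (EuclideanSpace ℝ (Fin 3))) volume (selfSimilarTransport (1 / (2 + ρ)) 0 V)
        (fun x => (1 / (2 + ρ)) • ContinuousLinearMap.id ℝ (EuclideanSpace ℝ (Fin 3)) + G x))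
    (hΨ : Measurable (Function.uncurry Ψ) ∧
      (∀ y : EuclideanSpace ℝ (Fin 3), Ψ 0 y = y) ∧
      (∀ᵐ y ∂(volume : Measure (EuclideanSpace ℝ (Fin 3))), ∀ σ : ℝ, 0 ≤ σ →
        IntervalIntegrable (fun s => selfSimilarTransport (1 / (2 + ρ)) 0 V (Ψ s y)) volume 0 σ ∧
          Ψ σ y = y - ∫ s in (0 : ℝ)..σ, selfSimilarTransport (1 / (2 + ρ)) 0 V (Ψ s y)) ∧
      (∀ σ s : ℝ, 0 ≤ σ → 0 ≤ s → ∀ᵐ y ∂(volume : Measure (EuclideanSpace ℝ (Fin 3))), Ψ (σ + s) y = Ψ σ (Ψ s y)) ∧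
      (∀ σ : ℝ, 0 ≤ σ →
        Measure.map (Ψ σ) (volume : Measure (EuclideanSpace ℝ (Fin 3))) =
          ENNReal.ofReal (Real.exp (3 * (1 / (2 + ρ)) * σ)) • (volume : Measure (EuclideanSpace ℝ (Fin 3))))) :
    ∀ (f : EuclideanSpace ℝ (Fin 3) → ℝ) (g : EuclideanSpace ℝ (Fin 3) → EuclideanSpace ℝ (Fin 3) →L[ℝ] ℝ),
      HasWeakFDerivOn (⊤ : Opens (EuclideanSpace ℝ (Fin 3))) volume f g →
      (∀ r : ℝ, MemLp g (3 / 2 : ℝ≥0∞) (volume.restrict (ball (0 : EuclideanSpace ℝ (Fin 3)) r))) →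
      ∀ σ : ℝ, 0 ≤ σ → ∀ᵐ y ∂(volume : Measure (EuclideanSpace ℝ (Fin 3))),
        IntervalIntegrable (fun s => g (Ψ s y) (selfSimilarTransport (1 / (2 + ρ)) 0 V (Ψ s y))) volume 0 σ ∧
          f (Ψ σ y) = f y - ∫ s in (0 : ℝ)..σ, g (Ψ s y) (selfSimilarTransport (1 / (2 + ρ)) 0 V (Ψ s y)) := by
  intro f g hfg hg32 σ hσ
  obtain ⟨hVG, -, hV6, -⟩ := hPG
  obtain ⟨hΨm, -, hcurve, -, hjac⟩ := hΨ
  have hVm : AEStronglyMeasurable V volume := by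
    have h := hVG.locallyIntegrableOn.aestronglyMeasurable
    simpa only [Opens.coe_top, Measure.restrict_univ] using h
  have hγ : (0 : ℝ) ≤ 1 / (2 + ρ) := by positivity
  exact chainRule_core hγ hVm hV6 hΨm hcurve hjac hfg hg32 hσ

end Summit.NavierStokesRegularity.NavierStokesRegularity.Theorems.PowerGaugeEulerLiouville.WeakLagrangian

end
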